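import Summits.ValiantsHypothesis.ValiantsHypothesis.Theorems.GrenetZeonDualUnipotentThreeHalvesSlowCoreCoarsen

/-!
# `GrenetZeon.DualUnipotentThreeHalves` (stmt-ValiantsHypothesis-24318), line `slow_core`, stub (c) `SlowCore.LongMassSlowLawInv`:
# THE CYCLIC ROW — a PERIODIC FREEZE prices every block-CYCLIC pencil with `L` levels at `n·⌈(n−1)/L⌉ + (off-wrap mass)`

Every certificate in the (c)-menu so far is of FLAG type: a level function that the pencil never raises (Borel / parabolic / triangularisable
value space and its by-name sources Engel, Radjavi, Jacobson, Kolchin).  This file lands the first certificate for a genuinely NON-FLAG support: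
pencils supported on a directed CYCLE of `L` levels — `N i j ≠ 0` only if `lvl i = lvl j + 1` (an up-arrow) or `lvl j = L − 1, lvl i = 0` (a
wrap arrow).  Such pencils never respect a flag (the support digraph is strongly connected); their nilpotency, when it holds, comes from the
cycle products, not from levels.  THE PERIODIC FREEZE: freeze every non-zero up-entry (`K = freezeSpace N R`, `R` = non-zero entries whose source
level is below the top) and leave the wrap arrows FREE.  Along `v ∈ K` a walk of length `e` from column `j` to row `i` in the line matrix
`N(x + s v)` picks up a factor `s` only on wrap arrows, and the level rises by one on every other step, so

  `L · deg_s (N(x + s v)^e)_{ij} + lvl i ≤ e + lvl j`   (★ `pow_lineSubst_degree_le`, induction on `e`),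

i.e. the `s`-degree is at most `⌈(e − (lvl i − lvl j))/L⌉ ≤ (n + L − 2)/L` in the window `e ≤ n − 1`.  Hence

* ★★ `relCert_of_cyclicSupport` — `RelCert n b N (n·((n + L − 2)/L) + R.card)`, `R.card ≤` the number of non-zero off-wrap entries (at most
  `Σ_{p < L−1} s_{p+1}·s_p` for level sizes `s_p`).  NO nilpotency, flag or irreducibility hypothesis is used.
* Reading for (c) (`b × b` constituents, budget `c·√n·b`): with `L` equal levels the price is `≈ n²/L + (L−1)·b²/L²`, so block-cyclic designs
  («rings of fat blocks») are CHEAP as soon as `L ≥ max(n^{3/2}/b, b/√n)/c` — e.g. `b = n`, `L ≥ √n`: price `≤ 2 n^{3/2}` — the OPPOSITE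
  regime to the parabolic certificate (cheap for FEW levels).  A ring-shaped (c)-violator must have FEW levels (`L ≪ b/√n`, fat blocks), where
  this row is silent and the bipartite/graft analysis (✓ `…BipartiteGraft*`, `L = 2`) takes over.  Violator portrait gains: «not a long ring».

HONEST FRAMING.  A new certificate MECHANISM (`--supports stmt-ValiantsHypothesis-24318`), not progress on the research stub (c)
`SlowCore.LongMassSlowLawInv` in its hard regime; closes no stub; S3, 24318, 8062 and `VP ≠ VNP` are NOT proved.  Def-free, no named-fact
hypotheses, no sorry. [folklore: weighted walks on a cycle]
-/

set_option linter.dupNamespace false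
set_option autoImplicit false

noncomputable section

namespace Summit.ValiantsHypothesis.ValiantsHypothesis.Theorems.GrenetZeon.CyclicGrading

open MvPolynomial Matrix
open scoped BigOperators
open Summit.ValiantsHypothesis.ValiantsHypothesis.Cruxes.TwoDimCoefficients.DimTwoCases (AffMat IsAffine)
open Summit.ValiantsHypothesis.ValiantsHypothesis.Theorems.GrenetZeon.RadicalSplit (lineSubst)
open Summit.ValiantsHypothesis.ValiantsHypothesis.Theorems.GrenetZeon.SlowCore

variable {n b : ℕ}

/-! ## §1 Entries of the line matrix under the periodic freeze -/

/-- A zero entry stays zero on every line. -/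
theorem lineSubst_entry_eq_zero (N : AffMat n b) (x v : Fin n × Fin n → ℂ) {i j : Fin b} (h : N i j = 0) :
    (N.map (lineSubst x v)) i j = 0 := by
  rw [Matrix.map_apply, h, map_zero]

/-- A frozen entry is constant on the line: `s`-degree `0`. -/
theorem totalDegree_entry_eq_zero_of_linEntry (N : AffMat n b) (hN : IsAffine N) (x v : Fin n × Fin n → ℂ) {i j : Fin b}
    (h : linEntry N i j v = 0) : ((N.map (lineSubst x v)) i j).totalDegree = 0 := by
  rw [Matrix.map_apply, lineSubst_apply_of_le_one N hN x v i j, h, C_0, zero_mul, add_zero, totalDegree_C]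

/-- Every entry of the line matrix of an affine pencil has `s`-degree `≤ 1`. -/
theorem totalDegree_entry_le_one (N : AffMat n b) (hN : IsAffine N) (x v : Fin n × Fin n → ℂ) (i j : Fin b) :
    ((N.map (lineSubst x v)) i j).totalDegree ≤ 1 := by
  rw [Matrix.map_apply]
  exact totalDegree_lineSubst_le_one x v (hN i j)

/-! ## §2 The walk count: `L · deg + lvl i ≤ e + lvl j` -/

/-- ★ **PERIODIC WALK COUNT.**  Let the affine pencil `N` be supported on the cycle of `L` levels (`N i j ≠ 0 ⇒ lvl i = lvl j + 1` or
`(lvl j + 1 = L ∧ lvl i = 0)`), and let `v` freeze every non-zero entry whose source level is below the top (`lvl j + 1 ≠ L`).  Then for every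
`e` and all `i j`, the entry `(N(x + s v)^e)_{ij}` is either `0` or has `s`-degree `d` with `L·d + lvl i ≤ e + lvl j`. -/
theorem pow_lineSubst_degree_le (N : AffMat n b) (hN : IsAffine N) {L : ℕ} (lvl : Fin b → ℕ) (hlvl : ∀ i, lvl i < L)
    (hsupp : ∀ i j, N i j ≠ 0 → lvl i = lvl j + 1 ∨ (lvl j + 1 = L ∧ lvl i = 0))
    (x v : Fin n × Fin n → ℂ) (hv : ∀ i j, N i j ≠ 0 → lvl j + 1 ≠ L → linEntry N i j v = 0) :
    ∀ e : ℕ, ∀ i j : Fin b, ((N.map (lineSubst x v)) ^ e) i j = 0 ∨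
      L * (((N.map (lineSubst x v)) ^ e) i j).totalDegree + lvl i ≤ e + lvl j := by
  classical
  set Q := N.map (lineSubst x v) with hQ
  intro e
  induction e with
  | zero =>
    intro i j
    by_cases hij : i = j
    · subst hij
      right
      rw [pow_zero, Matrix.one_apply_eq, ← C_1, totalDegree_C]
      omega
    · left
      rw [pow_zero, Matrix.one_apply_ne hij]
  | succ e ih =>
    intro i j
    -- `(X^(e+1))_{ij} = Σ_l (X^e)_{il} X_{lj}`; bound every term
    have hterm : ∀ l : Fin b, (Q ^ e) i l * Q l j = 0 ∨
        L * ((Q ^ e) i l * Q l j).totalDegree + lvl i ≤ (e + 1) + lvl j := by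
      intro l
      by_cases hN0 : N l j = 0
      · left; rw [hQ, lineSubst_entry_eq_zero N x v hN0, mul_zero]
      rcases ih i l with h0 | hdeg
      · left; rw [h0, zero_mul]
      right
      have hmul : ((Q ^ e) i l * Q l j).totalDegree ≤ ((Q ^ e) i l).totalDegree + (Q l j).totalDegree := totalDegree_mul _ _
      rcases hsupp l j hN0 with hup | ⟨htop, hzero⟩
      · -- up-arrow: frozen, degree `0`, the level rises by one
        have hfz : (Q l j).totalDegree = 0 :=
          totalDegree_entry_eq_zero_of_linEntry N hN x v (hv l j hN0 (by have := hlvl l; omega))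
        rw [hfz, add_zero] at hmul
        have := Nat.mul_le_mul_left L hmul
        omega
      · -- wrap arrow: free, degree `≤ 1`, the level drops from `L − 1` to `0`
        have h1 : (Q l j).totalDegree ≤ 1 := totalDegree_entry_le_one N hN x v l j
        have := Nat.mul_le_mul_left L (hmul.trans (Nat.add_le_add_left h1 _))
        rw [Nat.mul_add, Nat.mul_one] at this
        omega
    rw [pow_succ, Matrix.mul_apply]
    by_cases hall : ∀ l : Fin b, (Q ^ e) i l * Q l j = 0
    · left; exact Finset.sum_eq_zero fun l _ => hall l
    · right
      push Not at hall
      obtain ⟨l₀, hl₀⟩ := hall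
      have hB : lvl i ≤ (e + 1) + lvl j := by
        rcases hterm l₀ with h | h
        · exact absurd h hl₀
        · exact le_trans (Nat.le_add_left _ _) h
      -- every term has degree `≤ ((e+1) + lvl j − lvl i) / L`
      have hLpos : 0 < L := by have := hlvl i; omega
      have hdeg : ∀ l : Fin b, ((Q ^ e) i l * Q l j).totalDegree ≤ ((e + 1) + lvl j - lvl i) / L := by
        intro l
        rcases hterm l with h | h
        · rw [h, totalDegree_zero]; exact Nat.zero_le _
        · rw [Nat.le_div_iff_mul_le hLpos]; rw [Nat.mul_comm]; omega
      have hsum : (∑ l, (Q ^ e) i l * Q l j).totalDegree ≤ ((e + 1) + lvl j - lvl i) / L :=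
        (totalDegree_finsetSum _ _).trans (Finset.sup_le fun l _ => hdeg l)
      have := Nat.div_mul_le_self ((e + 1) + lvl j - lvl i) L
      have h2 := Nat.mul_le_mul_right L hsum
      rw [Nat.mul_comm] at h2
      omega

/-! ## §3 THE CYCLIC ROW -/

/-- ★★ **THE CYCLIC ROW (periodic freeze).**  An affine `b × b` pencil supported on the directed cycle of `L ≥ 1` levels (up-arrows
`lvl i = lvl j + 1` and wrap arrows from the top level `L − 1` to level `0`) has the whole-pencil certificate
`K = freezeSpace N R` (`R` = the non-zero entries with source level below the top, i.e. all non-zero up-entries), window order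
`(n + L − 2)/L = ⌈(n − 1)/L⌉`, hence `RelCert n b N (n·((n + L − 2)/L) + R.card)`.  No nilpotency or flag hypothesis. [folklore] -/
theorem relCert_of_cyclicSupport (N : AffMat n b) (hN : IsAffine N) {L : ℕ} (lvl : Fin b → ℕ) (hlvl : ∀ i, lvl i < L)
    (hsupp : ∀ i j, N i j ≠ 0 → lvl i = lvl j + 1 ∨ (lvl j + 1 = L ∧ lvl i = 0)) :
    RelCert n b N (n * ((n + L - 2) / L) +
      (Finset.univ.filter fun ij : Fin b × Fin b => N ij.1 ij.2 ≠ 0 ∧ lvl ij.2 + 1 ≠ L).card) := by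
  classical
  set R : Finset (Fin b × Fin b) := Finset.univ.filter fun ij : Fin b × Fin b => N ij.1 ij.2 ≠ 0 ∧ lvl ij.2 + 1 ≠ L with hR
  refine ⟨freezeSpace N R, (n + L - 2) / L, ?_, ?_⟩
  · -- the ledger: every power `e ≤ n − 1` has `s`-degree `≤ (n + L − 2)/L` along `v ∈ freezeSpace N R`
    intro x v hv e he i j _ _
    have hfz : ∀ i j, N i j ≠ 0 → lvl j + 1 ≠ L → linEntry N i j v = 0 := fun i j hij hj =>
      linEntry_eq_zero_of_mem_freezeSpace N R (by rw [hR, Finset.mem_filter]; exact ⟨Finset.mem_univ _, hij, hj⟩) hv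
    have hLpos : 0 < L := by
      rcases Nat.eq_zero_or_pos b with hb | hb
      · subst hb; exact Fin.elim0 i
      · have := hlvl i; omega
    rcases Nat.eq_zero_or_pos e with he0 | he0
    · -- `e = 0`: the entries of `1` are constants
      subst he0
      rw [pow_zero, Matrix.one_apply]
      split_ifs
      · rw [← C_1, totalDegree_C]; exact Nat.zero_le _
      · rw [totalDegree_zero]; exact Nat.zero_le _
    rcases pow_lineSubst_degree_le N hN lvl hlvl hsupp x v hfz e i j with h0 | hdeg
    · rw [h0, totalDegree_zero]; exact Nat.zero_le _
    · set d := (((N.map (lineSubst x v)) ^ e) i j).totalDegree with hd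
      have hj := hlvl j
      have h3 : L * d ≤ n + L - 2 := by
        have h4 : L * d + lvl i ≤ (n - 1) + lvl j := le_trans hdeg (by omega)
        omega
      exact (Nat.le_div_iff_mul_le hLpos).mpr (by rw [Nat.mul_comm]; exact h3)
  · -- the price: `codim (freezeSpace N R) ≤ R.card`
    have h := codim_freezeSpace_le N R
    omega

/-- ★ **(c) ON LONG RINGS**, stub binder shape: a `b × b` affine pencil supported on a cycle of `L` levels, with at most `D` non-zero off-wrap
entries and `n·((n + L − 2)/L) + D ≤ c·(⌊√n⌋·b)`, satisfies (c)'s conclusion `RelCert n b B (c·(⌊√n⌋·b))` — e.g. `L ≥ √n` equal levels of a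
`b = n` ring at `c = 2 + o(1)`.  (NOT an instance of the stub: no claim for short rings.) [folklore] -/
theorem longMass_on_cyclic_locus {c : ℕ} (n b : ℕ) (B : AffMat n b) (hB : IsAffine B) {L : ℕ} (lvl : Fin b → ℕ)
    (hlvl : ∀ i, lvl i < L) (hsupp : ∀ i j, B i j ≠ 0 → lvl i = lvl j + 1 ∨ (lvl j + 1 = L ∧ lvl i = 0))
    (hbudget : n * ((n + L - 2) / L) +
      (Finset.univ.filter fun ij : Fin b × Fin b => B ij.1 ij.2 ≠ 0 ∧ lvl ij.2 + 1 ≠ L).card ≤ c * (Nat.sqrt n * b)) :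
    RelCert n b B (c * (Nat.sqrt n * b)) := by
  obtain ⟨K, k, hK, hprice⟩ := relCert_of_cyclicSupport B hB lvl hlvl hsupp
  exact ⟨K, k, hK, hprice.trans hbudget⟩

end Summit.ValiantsHypothesis.ValiantsHypothesis.Theorems.GrenetZeon.CyclicGrading

end
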